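import Literature.AlgebraicGeometry.Morphisms.FormalFunctionsCechProofs
import Mathlib.RingTheory.Filtration
import HarnessLib

/-!
# The theorem on formal functions for `H⁰`: reduction to levelwise lifting and Artin–Rees stability

Sibling proofs file of `Literature/AlgebraicGeometry/Morphisms/FormalFunctions.lean` (named fact
`Literature.AlgebraicGeometry.Morphisms.formalFunctions_H0`: The Stacks Project, Tag 02OC =
Cohomology of Schemes, Theorem 30.20.5, case `p = 0`, `𝓕 = 𝒪_X`). It records, for an arbitrary
ideal `I ⊆ A` and an arbitrary `A`-scheme `f : X → Spec A` (no flatness, `I` not principal), the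
skeleton of the *direct proof* of the theorem of formal functions in Görtz–Wedhorn,
*Algebraic Geometry II*, Theorem 24.37 with Section (24.7) (PDF pp. 525–529): writing
`M = Γ(X, 𝒪_X)`, `X_n = X ×_A A/I^{n+1}` and

* `K_n = ker (M → Γ(X_n, 𝒪_{X_n})) = Γ(X, 𝓘^{n+1})` (`𝓘 = I 𝒪_X`; the `E_k` of loc. cit.), an
  `I Γ(X, 𝒪_X)`-filtration of the ring `Γ(X, 𝒪_X)` (`kerFiltration I f`: `K_{n+1} ⊆ K_n` and
  `I K_n ⊆ K_{n+1}`, the latter because vanishing on `X_{n+1}` is local and on an affine open `W`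
  one has `K_n|_W = I^{n+1} Γ(X, W)`, `mem_map_of_app_ι_eq_zero`), with `I^{n+1} M ⊆ K_n`;

the two inputs of that proof are separated as hypotheses:

* (LS) *levelwise lifting*: every family `s_n ∈ Γ(X_n, 𝒪)` compatible under the transition maps
  has each `s_n` in the image of `M` — in loc. cit. this is the Mittag-Leffler Lemma 24.40
  (`C_k = coker (M → Γ(X_{k-1}, 𝒪)) ⊆ H¹(X, I^k 𝒪_X)`, `⊕_k C_k` finite over the Rees algebra by the
  finiteness of `H¹`, Prop. 24.39 (1) for `p = 1`);
* (AR) *Artin–Rees stability* of the filtration `(K_n)`: `I K_n = K_{n+1}` for `n ≫ 0`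
  (Mathlib `Ideal.Filtration.Stable`) — in loc. cit. "`I H⁰(X, I^k 𝓕) = H⁰(X, I^{k+1} 𝓕)` for
  `k ≥ k₀`", from the finiteness of `⊕_k H⁰(X, I^k 𝒪_X)` over the Rees algebra (Prop. 24.39 (1) for
  `p = 0`; in Mathlib terms `Ideal.Filtration.submodule_fg_iff_stable`);

and we prove: (AR) gives `c` with `K_{n+c} ⊆ I^{n+1} M` for all `n`
(`exists_ker_restrict_le_of_stable`), hence the injectivity half `HasInjectiveFormalFunctions I f`
(`hasInjectiveFormalFunctions_of_ker_le`: an `I`-adic Cauchy sequence vanishing on every `X_n` is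
`I`-adically null); (LS) and (AR) together give the surjectivity half
`HasSurjectiveFormalFunctions I f` (`hasSurjectiveFormalFunctions_of_levelwise_of_ker_le`: lift
`s_{n+c}` to `m̃_{n+c} ∈ M` and put `m_n = m̃_{n+c}`; then `m_{n+1} - m_n ∈ K_{n+c} ⊆ I^{n+1} M` and
`m_n|_{X_n} = s_n`), so that both halves of `formalFunctions_H0` for the data `(A, I, f)` follow
from (LS) and (AR) (`formalFunctions_of_levelwise_of_stable`). What is NOT here: the proofs of
(LS) and (AR) for `A` Noetherian and `f` proper, which are the finiteness of `H¹` and `H⁰` of the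
quasi-coherent graded algebra `⊕_k I^k 𝒪_X` over the Rees algebra (Görtz–Wedhorn II, Prop. 24.39
(1); The Stacks Project, Tag 02O5), i.e. the content of the named fact
`Literature.AlgebraicGeometry.Morphisms.cechH1_finite` and its `H⁰` analogue applied to the proper
`Spec_X (⊕_k I^k 𝒪_X) → Spec (⊕_k I^k)`; Mathlib (pin v4.32) has no coherent cohomology of schemes.

## References

* U. Görtz, T. Wedhorn, *Algebraic Geometry II: Cohomology of Schemes*, Springer Spektrum (2023):
  Thm. 24.37, Prop. 24.39, Lemma 24.40 and the direct proof in Section (24.7) (PDF pp. 525–529).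
* The Stacks Project, Tag 02OC (Cohomology of Schemes, Theorem 30.20.5) and Tag 02O5
  (Proposition 30.19.1).
-/

noncomputable section

open CategoryTheory AlgebraicGeometry Limits TopologicalSpace Opposite

universe u

namespace Literature.AlgebraicGeometry.Morphisms

open infinitesimalNeighbourhood

variable {A : Type u} [CommRing A] (I : Ideal A) {X : Scheme.{u}} (f : X ⟶ Spec (.of A))

/-! ### The kernels `K_n = ker (Γ(X, 𝒪_X) → Γ(X_n, 𝒪_{X_n}))` -/

/-- `K_{n+1} ⊆ K_n`: a function vanishing on `X_{n+1}` vanishes on `X_n ⊆ X_{n+1}`. [folklore] -/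
theorem ker_restrict_succ_le (n : ℕ) :
    RingHom.ker (restrict I f (n + 1)) ≤ RingHom.ker (restrict I f n) := fun m hm ↦ by
  rw [RingHom.mem_ker] at hm ⊢
  rw [← transition_appTop_restrict I f n m, hm, map_zero]

/-- `I^{n+1} Γ(X, 𝒪_X) ⊆ K_n`. [folklore] -/
theorem map_pow_le_ker_restrict (n : ℕ) :
    (I ^ (n + 1)).map (algebraMapΓ f) ≤ RingHom.ker (restrict I f n) := fun _ hm ↦
  RingHom.mem_ker.mpr (restrict_eq_zero_of_mem_map I f n hm)

/-- Local form of `K_n`: on an affine open `W ⊆ X`, a global function vanishing on `X_n` restricts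
into `I^{n+1} Γ(X, W)` (`Γ(W_n, 𝒪) = Γ(X, W) / I^{n+1} Γ(X, W)`, `mem_map_of_app_ι_eq_zero`).
[folklore] -/
theorem resTop_mem_map_pow_of_mem_ker {n : ℕ} {m : Γ(X, ⊤)}
    (hm : m ∈ RingHom.ker (restrict I f n)) {W : X.Opens} (hW : IsAffineOpen W) :
    (resTop X W m : Sections f W) ∈ (I ^ (n + 1)).map (algebraMap A (Sections f W)) := by
  refine mem_map_of_app_ι_eq_zero f I n hW _ ?_
  change (ι I f n).app W (resTop X W m) = 0
  rw [app_resTop]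
  change resTop _ _ (restrict I f n m) = 0
  rw [RingHom.mem_ker.mp hm, map_zero]

/-- Vanishing on `X_k` is local on `X`: a global function whose restrictions to all affine opens
`W` pull back to `0` on `W_k ⊆ X_k` vanishes on `X_k` (sheaf condition on `X_k` for the cover
`(W_k)_W`). [folklore] -/
theorem restrict_eq_zero_of_forall_affineOpens {k : ℕ} (x : Γ(X, ⊤))
    (h : ∀ W : X.affineOpens, (ι I f k).app W (resTop X W x) = 0) : restrict I f k x = 0 := by
  let J := {W : X.affineOpens // (W : X.Opens) ≤ ⊤}
  apply (infinitesimalNeighbourhood I f k).sheaf.eq_of_locally_eq'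
    (fun W : J ↦ (ι I f k) ⁻¹ᵁ ((W : X.affineOpens) : X.Opens)) ⊤ (fun W ↦ homOfLE le_top)
    (by rw [← Scheme.Hom.preimage_iSup, iSup_affineOpens_le]; exact le_top)
  intro W
  change resTop _ _ ((ι I f k).appTop x) = resTop _ _ 0
  rw [map_zero, ← app_resTop, h W.1]

/-- **`I · K_n ⊆ K_{n+1}`**: for `a ∈ I` and `m ∈ Γ(X, 𝒪_X)` vanishing on `X_n`, `a m` vanishes on
`X_{n+1}` — locally on an affine open `W`, `m|_W ∈ I^{n+1} Γ(X, W)`, so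
`(a m)|_W ∈ I^{n+2} Γ(X, W)`, which dies on `W_{n+1}`. [folklore] -/
theorem idealΓ_mul_ker_restrict_le (n : ℕ) :
    idealΓ I f * RingHom.ker (restrict I f n) ≤ RingHom.ker (restrict I f (n + 1)) := by
  -- generators `a ∈ I` first
  have key : ∀ a ∈ I, ∀ m ∈ RingHom.ker (restrict I f n),
      algebraMapΓ f a * m ∈ RingHom.ker (restrict I f (n + 1)) := by
    intro a ha m hm
    rw [RingHom.mem_ker]
    refine restrict_eq_zero_of_forall_affineOpens I f _ fun W ↦ ?_
    have hle : (I ^ (n + 2)).map (algebraMap A (Sections f W)) ≤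
        RingHom.ker (appι f I (n + 1) W) :=
      Ideal.map_le_iff_le_comap.mpr fun b hb ↦ RingHom.mem_ker.mpr
        (appι_algebraMap_eq_zero f I (n + 1) W hb)
    have hmem : (resTop X W (algebraMapΓ f a * m) : Sections f W) ∈
        (I ^ (n + 2)).map (algebraMap A (Sections f W)) := by
      rw [map_mul, pow_succ', Ideal.map_mul]
      exact Ideal.mul_mem_mul (Ideal.mem_map_of_mem _ ha)
        (resTop_mem_map_pow_of_mem_ker I f hm W.2)
    exact RingHom.mem_ker.mp (hle hmem)
  -- then `I Γ(X, 𝒪_X)`-linear combinations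
  rw [Ideal.mul_le]
  intro x hx
  induction hx using Submodule.span_induction with
  | mem x hx =>
    obtain ⟨a, ha, rfl⟩ := hx
    exact key a ha
  | zero => intro m _; rw [zero_mul]; exact Ideal.zero_mem _
  | add x y _ _ hx hy => intro m hm; rw [add_mul]; exact Ideal.add_mem _ (hx m hm) (hy m hm)
  | smul r x _ hx => intro m hm; rw [smul_eq_mul, mul_assoc]; exact Ideal.mul_mem_left _ r (hx m hm)

/-- **The filtration `(K_n)_n` of `Γ(X, 𝒪_X)` by the kernels of the restrictions to the
infinitesimal neighbourhoods** `X_n = X ×_A A/I^{n+1}` (`K_n = Γ(X, 𝓘^{n+1})`, the `E_•` of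
Görtz–Wedhorn II, direct proof of Thm. 24.37), as an `I Γ(X, 𝒪_X)`-filtration in the sense of
Mathlib (`Ideal.Filtration`: decreasing, `I K_n ⊆ K_{n+1}`; it starts at `K_0`, not at `⊤`).
[cite: GortzWedhorn2023, Thm. 24.37, direct proof in Section (24.7) (PDF pp. 528–529)] -/
def kerFiltration : (idealΓ I f).Filtration Γ(X, ⊤) where
  N n := RingHom.ker (restrict I f n)
  mono n := ker_restrict_succ_le I f n
  smul_le n := (Ideal.smul_eq_mul _ _).trans_le (idealΓ_mul_ker_restrict_le I f n)

/-- Unfolding of `kerFiltration`. [folklore] -/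
@[simp]
theorem kerFiltration_N (n : ℕ) : (kerFiltration I f).N n = RingHom.ker (restrict I f n) := rfl

/-- (AR) **Artin–Rees stability gives `K_{n+c} ⊆ I^{n+1} Γ(X, 𝒪_X)`**: if `I K_n = K_{n+1}` for
`n ≥ n₀` then `K_{n+n₀+1} = I^{n+1} K_{n₀} ⊆ I^{n+1} Γ(X, 𝒪_X)` (Görtz–Wedhorn II, end of the direct
proof of Thm. 24.37: "`E_{r+k₀} = I^r E_{k₀} ⊆ I^r H`"). [cite: GortzWedhorn2023, Thm. 24.37, direct proof in Section (24.7) (PDF p. 529)] -/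
theorem exists_ker_restrict_le_of_stable (h : (kerFiltration I f).Stable) :
    ∃ c, ∀ n, RingHom.ker (restrict I f (n + c)) ≤ (I ^ (n + 1)).map (algebraMapΓ f) := by
  obtain ⟨n₀, hn₀⟩ := h.exists_pow_smul_eq_of_ge
  refine ⟨n₀ + 1, fun n ↦ ?_⟩
  have e : RingHom.ker (restrict I f (n + (n₀ + 1))) =
      idealΓ I f ^ (n + (n₀ + 1) - n₀) • RingHom.ker (restrict I f n₀) := hn₀ _ (by omega)
  have e' : n + (n₀ + 1) - n₀ = n + 1 := by omega
  rw [e, e', ← idealΓ_pow, Ideal.smul_eq_mul]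
  exact Ideal.mul_le_right

/-- In particular `(kerFiltration I f).Stable` follows from the finite generation of its Rees
module `⊕_n K_n` together with that of each `K_n` (Mathlib
`Ideal.Filtration.submodule_fg_iff_stable`) — this is where the finiteness of
`H⁰(X, ⊕_k I^k 𝒪_X)` over the Rees algebra (Görtz–Wedhorn II, Prop. 24.39 (1), `p = 0`) enters the
direct proof of the theorem of formal functions. [cite: GortzWedhorn2023, Prop. 24.39 (1) and Thm. 24.37, direct proof (PDF pp. 527–529)] -/
theorem kerFiltration_stable_of_fg (h₁ : ∀ n, ((kerFiltration I f).N n).FG)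
    (h₂ : (kerFiltration I f).submodule.FG) : (kerFiltration I f).Stable :=
  ((kerFiltration I f).submodule_fg_iff_stable h₁).mp h₂

/-! ### The two halves of the theorem on formal functions from (LS) and (AR) -/

/-- **Injectivity from (AR).** If `K_{n+c} ⊆ I^{n+1} Γ(X, 𝒪_X)` for all `n`, then
`HasInjectiveFormalFunctions I f`: for an `I`-adic Cauchy sequence `(m_n)` with `m_n|_{X_n} = 0`,
`m_n ≡ m_{n+c} (mod I^{n+1})` and `m_{n+c} ∈ K_{n+c} ⊆ I^{n+1} Γ(X, 𝒪_X)`. [cite: GortzWedhorn2023, Thm. 24.37, direct proof in Section (24.7) (PDF pp. 528–529)] -/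
theorem hasInjectiveFormalFunctions_of_ker_le {c : ℕ}
    (hc : ∀ n, RingHom.ker (restrict I f (n + c)) ≤ (I ^ (n + 1)).map (algebraMapΓ f)) :
    HasInjectiveFormalFunctions I f := by
  intro m hm h0 n
  have hdiff : ∀ j, m (n + j) - m n ∈ (I ^ (n + 1)).map (algebraMapΓ f) := by
    intro j
    induction j with
    | zero =>
      have e : m (n + 0) - m n = 0 := sub_self _
      rw [e]
      exact Ideal.zero_mem _
    | succ j ih =>
      rw [← Nat.add_assoc, ← sub_add_sub_cancel (m (n + j + 1)) (m (n + j)) (m n)]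
      exact Ideal.add_mem _ (Ideal.map_mono (Ideal.pow_le_pow_right (by omega)) (hm (n + j))) ih
  have hmem : m (n + c) ∈ (I ^ (n + 1)).map (algebraMapΓ f) :=
    hc n (RingHom.mem_ker.mpr (h0 (n + c)))
  rw [← sub_sub_cancel (m (n + c)) (m n)]
  exact Ideal.sub_mem _ hmem (hdiff c)

/-- **Surjectivity from (LS) and (AR).** If every compatible family `(s_n ∈ Γ(X_n, 𝒪))_n` has
each `s_n` in the image of `Γ(X, 𝒪_X)` (levelwise lifting, the Mittag-Leffler step) and
`K_{n+c} ⊆ I^{n+1} Γ(X, 𝒪_X)` for all `n` (Artin–Rees step), then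
`HasSurjectiveFormalFunctions I f`: choose lifts `m̃_n` of `s_n` and put `m_n = m̃_{n+c}`; then
`m_{n+1} - m_n ∈ K_{n+c} ⊆ I^{n+1} Γ(X, 𝒪_X)` and `m_n|_{X_n} = s_{n+c}|_{X_n} = s_n`. [cite: GortzWedhorn2023, Thm. 24.37, direct proof in Section (24.7) (PDF pp. 528–529)] -/
theorem hasSurjectiveFormalFunctions_of_levelwise_of_ker_le {c : ℕ}
    (hls : ∀ s : (n : ℕ) → Γ(infinitesimalNeighbourhood I f n, ⊤),
      (∀ n, (transition I f n).appTop.hom (s (n + 1)) = s n) →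
        ∀ n, ∃ m : Γ(X, ⊤), restrict I f n m = s n)
    (hc : ∀ n, RingHom.ker (restrict I f (n + c)) ≤ (I ^ (n + 1)).map (algebraMapΓ f)) :
    HasSurjectiveFormalFunctions I f := by
  intro s hs
  choose m' hm' using hls s hs
  -- restricting a lift of `s_{n+j}` down to `X_n` gives `s_n`
  have hdown : ∀ (j n : ℕ) (x : Γ(X, ⊤)),
      restrict I f (n + j) x = s (n + j) → restrict I f n x = s n := by
    intro j
    induction j with
    | zero => intro n x hx; exact hx
    | succ j ih =>
      intro n x hx
      apply ih
      rw [← transition_appTop_restrict, ← hs (n + j)]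
      exact congrArg _ hx
  refine ⟨fun n ↦ m' (n + c), fun n ↦ ?_, fun n ↦ hdown c n _ (hm' (n + c))⟩
  apply hc n
  rw [RingHom.mem_ker, map_sub, sub_eq_zero, hm' (n + c)]
  apply hdown 1 (n + c)
  show restrict I f (n + c + 1) (m' (n + 1 + c)) = s (n + c + 1)
  rw [show n + 1 + c = n + c + 1 by omega]
  exact hm' _

/-- **The theorem on formal functions for `H⁰` from levelwise lifting and Artin–Rees stability**
(the skeleton of the direct proof of Görtz–Wedhorn II, Thm. 24.37, for `p = 0`, `𝓕 = 𝒪_X`): for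
any ring `A`, ideal `I` and `A`-scheme `f : X → Spec A`, if (LS) every compatible family
`(s_n ∈ Γ(X_n, 𝒪))_n` lifts levelwise to `Γ(X, 𝒪_X)` and (AR) the filtration
`K_n = ker (Γ(X, 𝒪_X) → Γ(X_n, 𝒪))` is `I`-stable (`I K_n = K_{n+1}` for `n ≫ 0`), then
`Γ(X, 𝒪_X)^∧ → lim_n Γ(X_n, 𝒪_{X_n})` is bijective, i.e. both halves
`HasSurjectiveFormalFunctions I f ∧ HasInjectiveFormalFunctions I f` of
`Literature.AlgebraicGeometry.Morphisms.formalFunctions_H0` hold for `(A, I, f)`. For `A`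
Noetherian and `f` proper, (LS) and (AR) are the finiteness of `H¹` and `H⁰` of `⊕_k I^k 𝒪_X`
over the Rees algebra (loc. cit., Prop. 24.39 (1) and Lemma 24.40), not proved here.
[cite: GortzWedhorn2023, Thm. 24.37 with Prop. 24.39 (1) and Lemma 24.40, direct proof in Section (24.7) (PDF pp. 525–529)] -/
theorem formalFunctions_of_levelwise_of_stable
    (hls : ∀ s : (n : ℕ) → Γ(infinitesimalNeighbourhood I f n, ⊤),
      (∀ n, (transition I f n).appTop.hom (s (n + 1)) = s n) →
        ∀ n, ∃ m : Γ(X, ⊤), restrict I f n m = s n)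
    (hst : (kerFiltration I f).Stable) :
    HasSurjectiveFormalFunctions I f ∧ HasInjectiveFormalFunctions I f := by
  obtain ⟨c, hc⟩ := exists_ker_restrict_le_of_stable I f hst
  exact ⟨hasSurjectiveFormalFunctions_of_levelwise_of_ker_le I f hls hc,
    hasInjectiveFormalFunctions_of_ker_le I f hc⟩

end Literature.AlgebraicGeometry.Morphisms

end
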